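import Mathlib
import HarnessLib
import Literature.NumberTheory.Automorphic.AutomorphicInductionCuspidal
import Literature.NumberTheory.Automorphic.GLnAdelicStructureProofs
import Literature.NumberTheory.Automorphic.GaloisActionPlaces
import Literature.NumberTheory.Automorphic.ArthurClozelBaseChange
import Literature.NumberTheory.Automorphic.PairLFunctionPoles
import Literature.NumberTheory.Automorphic.PairLFunctionPolesRepData
import Literature.NumberTheory.GaloisRepresentations.HeckeCharacter
import Literature.FieldTheory.Galois.SolvableCompositum
import Summits.Langlands.Langlands.Theses.ExteriorSquareAscent
import Summits.Langlands.Langlands.Theorems.ExteriorSquareAscentSelfTwistedIrreducibleDefs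
import Summits.Langlands.Langlands.Theorems.ExteriorSquareAscentSelfTwistedIrreducibleStubDoubledDetIsHecke
import Summits.Langlands.Langlands.Theorems.ExteriorSquareAscentSelfTwistedIrreducibleStubDescent
import Summits.Langlands.Langlands.Theorems.ExteriorSquareAscentSelfTwistedIrreducibleStubAutomorphicInduction
import Summits.Langlands.Langlands.Theorems.ExteriorSquareAscentSelfTwistedIrreducibleStubNoFourCharacters
import Summits.Langlands.Langlands.Theorems.ExteriorSquareAscentSelfTwistedIrreducibleStubCliffordDichotomy
import Summits.Langlands.Langlands.Theorems.ExteriorSquareAscentSelfTwistedIrreducibleStubPinnedDoublingKill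

/-!
# Skeleton of line `Sketch` (idea det-pinning) for crux stmt-Langlands-18055
`Summit.Langlands.Langlands.Theses.ExteriorSquareAscent.SelfTwistedIrreducible`

Route `route-Langlands-ExteriorSquareAscent`; lead prover-line-stmt-Langlands-18055-0 (2026-08-17).
The crux: for every number field `K`, every cuspidal C-algebraic `π` on `GL₄(𝔸_K)` with a Hecke field
which is self-twisted by the quadratic sign of some quadratic `L/K` a.e., every semisimple
`ρ : Γ_K → GL₄(ℚ̄_ℓ)` Satake–Frobenius compatible with `(π, ι)` a.e. is irreducible.

## The cut (7 registered stubs; everything after stub 2 lives over `L`, so the stubs are independent)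

* `stub_facts` — the line's DEBT: the unproved named facts of the tree it leans on, by name
  (Arthur–Clozel Thm 4.2(b) `ArthurClozel1989_inducedLift_of_twist_eq`; multiplicity one
  `multiplicity_one_gl`; Jacquet–Shalika (2.2)/(2.3) in the `L²` model
  `JacquetShalika1981_partialPairL_at_one_of_ne_conj` / `…_pole_of_eq_conj`, and for Borel–Jacquet data
  `JacquetShalika1981_partialPairL_boundary_repData` / `…_pole_repData`). Never proved here.
* `stub_automorphicInduction` (facts F1–F4 ⇒) `π` self-twisted by `ε_{L/K}` ⇒ `π = AI_{L/K}(f)` with `f`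
  cuspidal on `GL₂/L`, `f` not Galois-stable (`IsAutomorphicInductionAlong f.1 π.1`,
  `¬ IsGaloisStableSatakeAE K f.1`). Route: class-field character `η` (`exists_isClassFieldCharacter_holds`,
  values `quadraticSign` a.e.), unitary `L²` avatar `P` of `π` (`exists_satake_eq_cpow_mul_L2_unconditional`),
  Satake self-twist ⇒ `P ⊗ η = P` (pattern of `twistByFiniteOrderChar_eq_self_of_isSatakeTwistBy`, rank 4),
  F1 ⇒ `Q₁` on `GL₂/L` with `IsWeakBaseChangeLiftOfGalOrbit`, `eventually_sum_eq_map_pow`, back to a datum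
  (`exists_cuspidalRepData_eventually_hasSatakeParamAt` + norm twist), (6.5)⇒(6.1)–(6.2)
  (`satakePolynomial_eq_inducedSatakePolynomial_of_sum_smul_eq`), non-stability
  (`IsAutomorphicInductionAlong.not_isGaloisStableSatakeAE_of_cuspidal`).
* `stub_descent` — `ρ|_{Γ_L}` is semisimple (`isSemisimple_restrictField`), `E`-rational a.e. (Hecke field:
  `e_j(q^{3/2}α) = q^{j(j-1)/2} · (q^{j(4-j)/2} e_j(α)) ∈ E`; inert places through `Frob_w ≡ Frob_v²`), and
  compatible with `f ⊞ f^τ` (`hasFrobCharpolyAt_restrictField_arithFrobPolyOfSatake`; split `v`: `α = β_w + β_{τw}`,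
  inert `v`: `α² = β_w + β_w`).
* `stub_cliffordDichotomy` — `ρ` semisimple, compatible, REDUCIBLE ⇒ `ρ|_{Γ_L}` is a sum of four characters
  (A) or doubled `W ⊕ W` (B) on characteristic polynomials (no irreducibility of `W`). Route: quadratic character
  `ε` with kernel `res(Γ_L)`; `ρ ⊗ ε` and `ρ` have the same Frobenius charpolys a.e. (self-twist) ⇒ equivalent
  (`nonempty_equiv_of_hasFrobCharpolyAt_eventually`, Chebotarev + Brauer–Nesbitt); the intertwiner `T` and
  semisimplicity give the two shapes by a case analysis on stable lines/planes (Schur for the irreducible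
  blocks).
* `stub_noFourCharacters` (facts F5–F6 ⇒) shape (A) is impossible: Böckle–Hui (PROVED,
  `exists_heckeCharacter_of_weaklyDivides_holds`) turns the four characters into Hecke characters `ψ_i` of `L`
  with `t_{f,w} ⊔ t_{f,τw} = {ψ_i(ϖ_w)}` a.e.; isobaric rigidity (pattern of
  `CuspidalAutomorphicRepData.not_eventually_satake_eq_sum_of_JS`, with `L^S(f^τ × ψ) = L^S(f × ψ∘τ)` by
  reindexing) kills it.
* `stub_doubledDetIsHecke` — shape (B) ⇒ `det W` is `E`-rational (monic square root of an `E`-rational square),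
  hence Hecke by rank-one Böckle–Hui: a `χ` with `HasPinnedDoubling τ f χ` (`t_{f,w} ⊔ t_{f,τw} = {x,x,y,y}`,
  `χ(ϖ_w) = q_w³ x y`).
* `stub_pinnedDoublingKill` — a pinned doubling forces `IsGaloisStableSatakeAE K f.1`: `ν := χ·N³·ω_f⁻¹`
  (`centralCharacter_satake_of_cuspidal`, `exists_heckeCharacter_ideleNorm_cpow`) is `1` on the good pairs and
  `≠ 1` exactly on the bad (scalar) pairs; if `ν ≠ 1`, Hecke (`heckeLFunction_continuation_ne_zero_of_re_eq_one`
  / Dedekind ζ off `s = 1`) bounds `Σ_w ν(ϖ_w) q_w^{-σ}` so the bad set carries `≥ ½ Σ_w q_w^{-σ}`, while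
  Rankin–Selberg positivity (`partialPairL_conjFamily_eq_exp_LSeries`, `summable_normSq_trace_satakePow_holds`,
  simple pole `JacquetShalika1981_partialPairL_pole_of_eq_conj_holds_of_le_two`) caps the scalar set at `¼`.

`SelfTwistedIrreducible_of` is propositional glue (plus the proved `exists_algEquiv_ne_one_of_finrank_eq_two`).
The interface `def`s are landed verbatim as `Theorems/ExteriorSquareAscentSelfTwistedIrreducibleDefs.lean`
in this namespace so that landed stubs read byte-identically.

Disproof used: none exists yet for this crux (payload `disproof_path` absent on 2026-08-17T11:30Z;
`ledger crux ls`: Ideas ×3, Lines/birth only). Versus line `birth`: stubs 1–3 are birth's (stub 2 made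
explicit as the descent to `L`); birth's `stub_noDoubledShape` (refined SMO `1/9 < 1/8` + Weil avatar) is
replaced by stubs 5–6 (det-pinning), and `stub_noFourCharacters` is stated over `L` alone.
-/

noncomputable section

set_option linter.dupNamespace false

namespace Summit.Langlands.Langlands.Cruxes.SelfTwistedIrreducible.DetPinning

open scoped NumberField Polynomial Classical
open Filter Polynomial NumberField IsDedekindDomain Field
open Literature.NumberTheory.GaloisRepresentations Literature.NumberTheory.Automorphic
open Summit.Langlands.Langlands.Theses.ExteriorSquareAscent (SelfTwistedIrreducible)

/-! ## Interfaces

The interface `def`s (`HasHeckeField`, `IsQuadSelfTwisted`, `IsCompatibleWith`, `IsSumOfFourCharacters`,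
`IsDoubled`, `IsRationalAE`, `IsCompatibleAlong`, `HasPinnedDoubling`) and the read-back
`selfTwistedIrreducible_iff` are the LANDED file
`Theorems/ExteriorSquareAscentSelfTwistedIrreducibleDefs.lean` (p159153), imported above. -/

/-! ## Stubs -/

/-- Stub 0 (the line's unproved NAMED FACTS, taken from the tree by name; this stub is the line's
debt and is never "proved" by the line: (F1) Arthur–Clozel Ch. 3 Thm 4.2 (b); (F2) multiplicity one
for `GL_n`; (F3)–(F4) Jacquet–Shalika (2.2) at `s = 1` and (2.3) in the `L²` model; (F5)–(F6) the same
two facts for Borel–Jacquet data). -/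
theorem stub_facts :
    (∀ (n : ℕ) (F E : Type) [Field F] [NumberField F] [Field E] [NumberField E] [Algebra F E],
        ArthurClozel1989_inducedLift_of_twist_eq n F E) ∧
    (∀ (n : ℕ) (F : Type) [Field F] [NumberField F]
        (μ : MeasureTheory.Measure (AdelicGroupData.gl n F).automorphicQuotient)
        [(AdelicGroupData.gl n F).IsAutomorphicMeasure μ], multiplicity_one_gl n F μ) ∧
    (∀ (n : ℕ) (F : Type) [Field F] [NumberField F]
        (μ : MeasureTheory.Measure (AdelicGroupData.gl n F).automorphicQuotient)
        [(AdelicGroupData.gl n F).IsAutomorphicMeasure μ],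
        JacquetShalika1981_partialPairL_at_one_of_ne_conj (n := n) (K := F) (μ := μ)) ∧
    (∀ (n : ℕ) (F : Type) [Field F] [NumberField F]
        (μ : MeasureTheory.Measure (AdelicGroupData.gl n F).automorphicQuotient)
        [(AdelicGroupData.gl n F).IsAutomorphicMeasure μ],
        JacquetShalika1981_partialPairL_pole_of_eq_conj (n := n) (K := F) (μ := μ)) ∧
    JacquetShalika1981_partialPairL_boundary_repData ∧
    JacquetShalika1981_partialPairL_pole_repData := by
  sorry

/-! Stub 1 `stub_automorphicInduction` (facts F1–F4 ⇒ `π = AI_{L/K}(f)`, `f` cuspidal not Galois-stable)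
is LANDED: `Theorems/ExteriorSquareAscentSelfTwistedIrreducibleStubAutomorphicInduction.lean` (p160402). -/

/-! Stub 2 `stub_descent` (descent to `L`) is LANDED:
`Theorems/ExteriorSquareAscentSelfTwistedIrreducibleStubDescent.lean` (p160253), imported above. -/

/-! Stub 3 `stub_cliffordDichotomy` (reducible ρ ⇒ ρ|_{Γ_L} four characters or doubled) is LANDED:
`Theorems/ExteriorSquareAscentSelfTwistedIrreducibleStubCliffordDichotomy.lean` (p162162; algebra in
`…CliffordLemmas.lean` p161313 and `…CliffordDichotomy.lean` p161726). -/

/-! Stub 4 `stub_noFourCharacters` (facts F5–F6 ⇒ shape (A) impossible: Böckle–Hui + isobaric rigidity for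
`f ⊞ f^τ`) is LANDED: `Theorems/ExteriorSquareAscentSelfTwistedIrreducibleStubNoFourCharacters.lean` (p161419; aux
`…StubNoFourCharactersAux.lean` p160828). -/

/-! Stub 5 `stub_doubledDetIsHecke` (the doubled determinant is a Hecke character, pinned) is LANDED:
`Theorems/ExteriorSquareAscentSelfTwistedIrreducibleStubDoubledDetIsHecke.lean` (p160135), imported above. -/

/-! Stub 6 `stub_pinnedDoublingKill` (a pinned doubling forces Galois-stable Satake data) is LANDED:
`Theorems/ExteriorSquareAscentSelfTwistedIrreducibleStubPinnedDoublingKill.lean` (p162274; aux `…Aux.lean` p161256,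
`…Aux2.lean` p161570). -/

/-! ## Stub statements as named propositions -/

namespace _Goal

/-- The statement of `stub_facts`. -/
def stub_facts : Prop :=
  type_of% @Summit.Langlands.Langlands.Cruxes.SelfTwistedIrreducible.DetPinning.stub_facts

end _Goal

/-! ## Glue lemmas (proved) -/

/-- A degree-two extension of number fields has a non-trivial automorphism. [folklore] -/
theorem exists_algEquiv_ne_one_of_finrank_eq_two (K L : Type) [Field K] [NumberField K] [Field L]
    [NumberField L] [Algebra K L] (h2 : Module.finrank K L = 2) : ∃ τ : L ≃ₐ[K] L, τ ≠ 1 := by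
  haveI : FiniteDimensional K L := Module.finite_of_finrank_pos (by rw [h2]; exact two_pos)
  haveI : Algebra.IsSeparable K L := Algebra.IsSeparable.of_integral K L
  haveI : IsGalois K L := Literature.FieldTheory.Galois.isGalois_of_finrank_eq_two (F := K) h2
  have hcard : Nat.card (L ≃ₐ[K] L) = 2 := by rw [IsGalois.card_aut_eq_finrank, h2]
  by_contra h
  push Not at h
  haveI : Subsingleton (L ≃ₐ[K] L) := ⟨fun a b => by rw [h a, h b]⟩
  have : Nat.card (L ≃ₐ[K] L) ≤ 1 := Finite.card_le_one_iff_subsingleton.mpr inferInstance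
  omega

/-! ## The composition -/

/-- **Composition.** The open stubs (and the landed ones, by name) imply the crux BY NAME. -/
theorem SelfTwistedIrreducible_of (h₀ : _Goal.stub_facts) :
    SelfTwistedIrreducible := by
  obtain ⟨hF1, hF2, hF3, hF4, hF5, hF6⟩ := h₀
  intro K _ _ hcpt π _hC hE hST ℓ _ ι ρ hss hcomp
  obtain ⟨L, _, _, _, hdeg, htw⟩ := hST
  have hq : IsQuadSelfTwisted π L := ⟨hdeg, htw⟩
  obtain ⟨τ, hτ⟩ := exists_algEquiv_ne_one_of_finrank_eq_two K L hdeg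
  obtain ⟨f, hAI, hns⟩ :=
    stub_automorphicInduction hF1 hF2 hF3 hF4 K hcpt π L hq (isCompact_glFiniteIntegralLevel_holds 2 L)
  obtain ⟨hssL, hrat, hcompL⟩ := stub_descent K L τ hτ hdeg hcpt π _ f hAI hE ℓ ι ρ hss hcomp
  by_contra hirr
  rcases stub_cliffordDichotomy K hcpt π L hq ℓ ι ρ hss hcomp hirr with h4 | hdbl
  · exact stub_noFourCharacters hF5 hF6 K L τ hτ hdeg _ f ℓ ι (ρ.restrictField L) hssL hrat hcompL h4
  · obtain ⟨χ, hχ⟩ := stub_doubledDetIsHecke K L τ hτ hdeg _ f ℓ ι (ρ.restrictField L) hrat hcompL hdbl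
    exact hns (stub_pinnedDoublingKill K L τ hτ hdeg _ f χ hχ)

/-- By-name sanity check. -/
example : SelfTwistedIrreducible :=
  SelfTwistedIrreducible_of stub_facts

end Summit.Langlands.Langlands.Cruxes.SelfTwistedIrreducible.DetPinning

end
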